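import Mathlib
import Summits.Ventures.PercRepro.PuncturedLYMMixP1Q1Table1

/-!
# PercRepro — (SP) FOR `1` PAIRWISE DISJOINT PAIRS AND `1` PAIRWISE DISJOINT QUADRUPLES AT LEVEL `4`: THE COLUMN IDENTITIES (1)
(p10, gen 41)

For each free column class (`mass ≤ 5`): the rows obtained by removing a point of a member met in `v` points (class `d − e_{s,v} + e_{s,v−1}`, direction code of `(s, v − 1)`) and the `5 − mass` rows obtained by removing a free point carry total weight `1`; the member columns carry `2 · (1/2) = 1` and `4 · (1/4) = 1`.  Nothing here asserts (SP).
-/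

namespace PercRepro.PuncturedLYM.Split.TypeLift.MixP1Q1

/-- The column identity of the free column class `(0, 0, 0, 0)`. -/
theorem col_0000 (n : ℚ) (hd : den n ≠ 0) :
    5 * raw n 0 0 0 0 6 = 1 := by
  simp (config := {decide := true}) only [raw, sel, sel_0000, if_true, if_false]
  field_simp
  unfold den N_0000_F
  ring

/-- The column identity of the free column class `(0, 0, 0, 1)`. -/
theorem col_0001 (n : ℚ) (hd : den n ≠ 0) :
    3 * raw n 0 0 1 0 4 + 2 * raw n 0 0 0 1 6 = 1 := by
  simp (config := {decide := true}) only [raw, sel, sel_0001, sel_0010, if_true, if_false]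
  field_simp
  unfold den N_0010_D42 N_0001_F
  ring

/-- The column identity of the free column class `(0, 0, 1, 0)`. -/
theorem col_0010 (n : ℚ) (hd : den n ≠ 0) :
    2 * raw n 0 1 0 0 3 + 3 * raw n 0 0 1 0 6 = 1 := by
  simp (config := {decide := true}) only [raw, sel, sel_0010, sel_0100, if_true, if_false]
  field_simp
  unfold den N_0100_D41 N_0010_F
  ring

/-- The column identity of the free column class `(0, 1, 0, 0)`. -/
theorem col_0100 (n : ℚ) (hd : den n ≠ 0) :
    1 * raw n 0 0 0 0 2 + 4 * raw n 0 1 0 0 6 = 1 := by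
  simp (config := {decide := true}) only [raw, sel, sel_0000, sel_0100, if_true, if_false]
  field_simp
  unfold den N_0000_D40 N_0100_F
  ring

/-- The column identity of the free column class `(1, 0, 0, 0)`. -/
theorem col_1000 (n : ℚ) (hd : den n ≠ 0) :
    1 * raw n 0 0 0 0 0 + 4 * raw n 1 0 0 0 6 = 1 := by
  simp (config := {decide := true}) only [raw, sel, sel_0000, sel_1000, if_true, if_false]
  field_simp
  unfold den N_0000_D20 N_1000_F
  ring

/-- The column identity of the free column class `(1, 0, 0, 1)`. -/
theorem col_1001 (n : ℚ) (hd : den n ≠ 0) :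
    1 * raw n 0 0 0 1 0 + 3 * raw n 1 0 1 0 4 + 1 * raw n 1 0 0 1 6 = 1 := by
  simp (config := {decide := true}) only [raw, sel, sel_0001, sel_1001, sel_1010, if_true, if_false]
  field_simp
  unfold den N_0001_D20 N_1010_D42 N_1001_F
  ring

/-- The column identity of the free column class `(1, 0, 1, 0)`. -/
theorem col_1010 (n : ℚ) (hd : den n ≠ 0) :
    1 * raw n 0 0 1 0 0 + 2 * raw n 1 1 0 0 3 + 2 * raw n 1 0 1 0 6 = 1 := by
  simp (config := {decide := true}) only [raw, sel, sel_0010, sel_1010, sel_1100, if_true, if_false]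
  field_simp
  unfold den N_0010_D20 N_1100_D41 N_1010_F
  ring

/-- The column identity of the free column class `(1, 1, 0, 0)`. -/
theorem col_1100 (n : ℚ) (hd : den n ≠ 0) :
    1 * raw n 0 1 0 0 0 + 1 * raw n 1 0 0 0 2 + 3 * raw n 1 1 0 0 6 = 1 := by
  simp (config := {decide := true}) only [raw, sel, sel_0100, sel_1000, sel_1100, if_true, if_false]
  field_simp
  unfold den N_0100_D20 N_1000_D40 N_1100_F
  ring

end PercRepro.PuncturedLYM.Split.TypeLift.MixP1Q1
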